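import Summits.QuantumFields.YangMills.Theorems.BalabanUVNodesK0S5CollarNumerics
import HarnessLib

/-!
# K0⁷ `stub_prop8StepCoP13` (stmt-QuantumFields-20541), sub-target S5 — **THE FAR SLOT OF (161) DISTANCE-WEIGHTED**: [Balaban1985Variational] p. 303, (161) line 3 → 4 replaces the far
# datum `18d²L³Mε₀` of (155) (`M = M′R₁M₁`, p. 300) by `(d(y₁,y₂) + M_Δ)·18d²L³ε₀` — the factor `R₁M₁` of the cube size is ABSORBED BY THE COLLAR DISTANCE `R₁M₁ ≤ d(y₁,y₂)` to the far
# cells and then by `B₃`'s weight `(d(y₁,y₂) + 1)` of (162), so that the far coefficient of (164) carries NO `R₁M₁`; this file re-types this lineage's kernel-checked (161) ⇒ (164) chain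
# (S5 ROAD item (c) `K0FlatHBBound164P`, the socket P12 `K0S5HBRows164CoreCubeSeq`) with the FAR hypothesis `|X c| ≤ C_d·M_Δ·ε(j(c))·L^{k−j(c)}·(distBI D b c + 1)` and derives print's
# letters `|X c| ≤ C_d·ε(j(c))·L^{k−j(c)}·(R′ + M_Δ)`; the alternative road (unweighted slot, `C_d ∝ ρ`) gets its affine (163) threshold `(c₀ρ + c₁)e^{−δ₁ρ} ≤ θ` on the big-block grid

Cell `pub-ymgap`, width seat `pub-ymgap-k0-s1-w3` gen 5 (HUMAN RULING D-0149; START LIST v11 §k0-s1; bus CLAIM-1 of g5, INBOX l.30099).  `--kind proof --supports stmt-QuantumFields-20541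
--as helper`; count-neutral; def-free; nothing restated (P11 `hRowsSep_of_adm22_T4`, (c) `rows164_of_hDecayLetterD`, g0 `tilt_far_le`, N1 `exists_collar_multiple` BY NAME).

WHY (located by reading print against the socket).  P12's far hypothesis `|X c| ≤ C_d·M_Δ·ε(j(c))·L^{k−j(c)}` (p601600; consumed by dag-n07-w4's `letters10On_HB_cubeDomains_box(_of_centred)`)
has no distance weight.  At the record the far datum on a lower territory `Λ_j` of the tower of a cube of side `M` with collar `ρ` is, by (145)–(146)∕(151), of size `∝ (M + 2ρ)·ε₀`
(print: `8dL²Mε₀ ≥ 4d(M + R₁M₁)L²ε₀`, p. 301); fed into the unweighted slot this forces `C_d ∝ ρ` (or, as in `…_of_centred`, `ε ≡ β₂∕M` with `θ·β₂ ∝ θ·ρ`), and the displayed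
(163)-row `8C_dCB₃e^{−δ₁ρ} ≤ θ` becomes a `ρ·e^{−δ₁ρ}`-threshold, which N1's `K0S5CollarNumerics.exists_rho_h163` (constant prefactor) does not serve.  Print instead writes
(p. 303, (161) lines 3–5): *«+ dB₀ Σ_{y₂∈ℭ_k∖□_k} e^{−½δ₀d(y₁,y₂)}e^{−½δ₀R₁M₁}(L^{j₂}η)⁻¹18d²L³Mε₀ ≦ … + dB₀ Σ_{y₂∈ℭ_k∖□_k} e^{−½δ₀d(y₁,y₂)}(d(y₁,y₂) + M_Δ)(L^{j₂}η)⁻¹e^{−½δ₀R₁M₁}18d²L³ε₀ ≦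
18d³L³B₀ Σ_{y₂∈ℭ_k} e^{−½δ₀d(y₁,y₂)}(d(y₁,y₂) + 1)(L^{j₂}η)⁻¹·M_Δ max{ε₁, e^{−½δ₀R₁M₁}ε₀}»* — `M = M_ΔR₁M₁ ≤ d(y₁,y₂) + M_Δ` on the far cells, and the weight
`(d + 1)` is exactly the one of `B₃` (162).  The kernel chain of item (c) ALREADY carries that weight (`kernelSum_le_rowSum`, `row_le_of_kernel`, `rows164_of_hDecayLetterD` take the
effective datum `e^{−½δ₀d}|X c| ≤ β·(d + 1)·L^{k−j}`); only the two front lemmas `effDatum_of_near_far_levelRadii` ∕ `rows164_quarter_levelRadii` and P12's binder dropped it on the far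
side (`1 ≤ d + 1`).  This file restores it.

WHAT IS PROVED (sorry-free; axioms standard; no definition).
* §1 (carrier-generic P2 letters, `(P : Params) (k) (D : Domains P)`): ★ `effDatum_of_near_farW_levelRadii` — NEAR `|X c| ≤ β₁(d+1)L^{k−j}`, FAR `|X c| ≤ β₂·ε(j(c))·L^{k−j}·(d+1)` behind
  `R ≤ d`, the (2.60) layer separation and the rate tilt of g0's `B11Eq161HBChainLevelRadii` ⇒ the effective datum `e^{−½δ₀d}|X c| ≤ max{β₁, e^{−(½δ₀−τ)R}2^g β₂ ε(k)}·(d+1)L^{k−j}` (the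
  SAME conclusion as (c)'s unweighted lemma); ★★ `rows164_quarter_levelRadii_farW` — (164)'s four left-weighted rows `≤ ¼M_Δ·max{4CB₀B₃ε₁, θ·ε(k)}` from `HDecayLetterD` ∧
  `RowSum162` ∧ the weighted data ∧ (163′).
* §2 ★★★ `hbRows164_core_of_adm22_T4_farW (F : T4Family)` — P12's socket `hbRows164_core_of_adm22_T4` VERBATIM (same constants `M_h⁰, R₀, C, δ₀, δ₁, B₃`, same binder block) except the far
  hypothesis, now `∀ c, j(c) < K − n → |X c| ≤ C_d·M_Δ·ε(j(c))·L^{K−n−j(c)}·(distBI D b c + 1)`.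
* §3 PRINT'S LETTERS ★★ `hbRows164_core_of_adm22_T4_farCollar` — far datum `|X c| ≤ C_d·ε(j(c))·L^{K−n−j(c)}·(R′ + M_Δ)` with `1 ≤ M_Δ`, `0 ≤ R′`, `0 ≤ ε(j)` below the top
  (print's `18d²L³ε₀·M`, `M = M′R₁M₁ ≤ d + M_Δ`): since `R′ ≤ distBI D b c` on far cells (the core collar, P12's own hypothesis) `R′ + M_Δ ≤ M_Δ·(distBI + 1)` and §2 applies —
  `C_d` and `θ` FREE OF the collar; ★ `hbRows164_uniform_core_of_adm22_T4_farCollar` (`ε ≡ ε₀`: print's case (151)∕(155)).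
* §4 THE ALTERNATIVE ROAD'S NUMERICS (for consumers that keep the unweighted slot with `C_d = c₀ρ + c₁`): `affine_mul_exp_neg_le` (`(c₀t + c₁)e^{−δt} ≤ (2c₀∕δ + c₁)e^{−½δt}`),
  ★ `exists_collar_multiple_affine` (`∃ ρ, M₁ ∣ ρ ∧ R·M₁ ≤ ρ ∧ L₀ ≤ ρ ∧ (c₀ρ + c₁)e^{−δ₁ρ} ≤ θ`), `exists_rho_h163_affine` (the (163)-row with `C_d := c₀ρ + c₁`).
HONEST SCOPE: reals bookkeeping over this lineage's kernel-checked chain (lit-balaban's [Balaban1984PropagatorsII] Cor. 2.8 ∕ Prop. 2.7 ∕ Prop. 2.6 ∕ Lemma 2.1 behind P11); the DATA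
(160)∕(155) at the record (BRIDGE-92: dag-n07-e ∕ dag-n07-w5), the kernel formula of `H_V`, the weights and the tower are the consumer's; nothing of [15]∕[6]∕[B6-II] asserted or
discharged; `stub_prop8StepCoP13` ∕ K0⁷ NOT closed; N07 NOT discharged (5∕27 unmoved); one finite 𝕋⁴ programme at fixed ε — R4 closes the conditional finite-𝕋⁴ rung `BalabanLadder.UV`
ONLY; the YM mass gap (Clay) is NOT proved by any of this; nothing continuum ∕ ℝ⁴ ∕ OS.  No `def`, no `instance`, no `notation`, no `sorry`.

References: T. Bałaban, CMP **102** (1985) 277–309 [Balaban1985Variational] (144) p.300, (145)–(151) p.301, (155) p.302, (160)–(163) p.303, (164) p.304; CMP **96** (1984) 223–250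
[Balaban1984PropagatorsII] (2.1)–(2.2) p.224, (2.60) p.234, Cor. 2.8 p.249; CMP **109** (1987) 249–301 [Balaban1987RG1] (0.1) p.251.
-/

set_option autoImplicit false

noncomputable section

open scoped BigOperators

namespace Summit.QuantumFields.YangMills.Theorems.K0S5FarSlotWeighted

open Literature.MathematicalPhysics.QuantumFieldTheory.Balaban1983to89
open B6SectADomainsV1 (Domains)
open B6SectAOperatorsV1 (BondIdx dcE dcsE)
open B11Eq161HBChainLevelRadii (tilt_far_le le_two_pow_mul_of_comparable)
open T4Continuum (T4Family)
open Summit.QuantumFields.YangMills.Theorems.FlatCubeOpsText (Adm22 distBI)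
open Summit.QuantumFields.YangMills.Theorems.K0FlatCubeOpsTextP (HDecayLetterD RowSum162 IsLevWeight flatH levWeight_nonneg)
open Summit.QuantumFields.YangMills.Theorems.K0FlatHBBound164P (rows164_of_hDecayLetterD bondIdx_level_le)
open Summit.QuantumFields.YangMills.Theorems.K0FlatPortKernelRowsSepP (hRowsSep_of_adm22_T4)
open Summit.QuantumFields.YangMills.Theorems.K0S5HBRows164CoreCubeSeq (two_le_exp_quarter h163_of_core)
open Summit.QuantumFields.YangMills.Theorems.HalvingQuarterCubeSeq (distBI_nonneg)
open Summit.QuantumFields.YangMills.Theorems.K0S5CollarNumerics (exists_collar_multiple)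

/-! ## §1 (161) ⇒ (164) in the carrier-generic P2 letters with the FAR datum distance-weighted -/

section Carrier

variable {P : Params} {k : ℕ} {D : Domains P}

/-- ★ **THE EFFECTIVE DATUM, FAR SLOT DISTANCE-WEIGHTED** ((161) lines 3 → 5 of print): NEAR `|X(c)| ≤ β₁(d(b,c) + 1)L^{k−j(c)}` ((160)); FAR, at the radius of the cell's own level AND
with print's weight, `|X(c)| ≤ β₂·ε(j(c))·L^{k−j(c)}·(d(b,c) + 1)` (`ε(j) ≤ 2^{k−j}ε(k)`, `0 ≤ ε(k)`), behind the (144) separation `R ≤ d(b,c)` and the layer separation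
`G·(k − j(c) − g) ≤ d(b,c)` ([Balaban1984PropagatorsII] (2.60)); a rate tilt `0 ≤ τ ≤ ½δ₀` with `2 ≤ e^{τG}` pays `2^{k−j(c)}` (`tilt_far_le`) ⇒ the effective bound
`e^{−½δ₀d}|X(c)| ≤ max{β₁, e^{−(½δ₀−τ)R}·2^g·β₂·ε(k)}·(d(b,c) + 1)L^{k−j(c)}` — the conclusion of (c)'s `effDatum_of_near_far_levelRadii` unchanged, the weight `(d + 1)` now
CARRIED on the far side instead of inserted by `1 ≤ d + 1`. [cite: Balaban1985Variational, (155) p.302, (160)–(161) p.303, (144) p.300; Balaban1984PropagatorsII, (2.60) p.234] -/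
theorem effDatum_of_near_farW_levelRadii (dBI : PBond P 0 → BondIdx D → ℝ) {δ₀ τ β₁ β₂ R G : ℝ} {ε : ℕ → ℝ} {gap : ℕ}
    (hτ : 0 ≤ τ) (hτδ : τ ≤ δ₀ / 2) (h2 : 2 ≤ Real.exp (τ * G)) (hβ₂ : 0 ≤ β₂) (hεk : 0 ≤ ε k)
    (hεcomp : ∀ j, j ≤ k → ε j ≤ (2 : ℝ) ^ (k - j) * ε k)
    (near : BondIdx D → Prop) (X : BondIdx D → ℝ) (b : PBond P 0) (hd : ∀ c, 0 ≤ dBI b c) (hjk : ∀ c : BondIdx D, (c.1.1 : ℕ) ≤ k)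
    (hnear : ∀ c, near c → |X c| ≤ β₁ * ((dBI b c + 1) * (P.L : ℝ) ^ (k - (c.1.1 : ℕ))))
    (hfar : ∀ c, ¬ near c →
      |X c| ≤ β₂ * ε (c.1.1 : ℕ) * (P.L : ℝ) ^ (k - (c.1.1 : ℕ)) * (dBI b c + 1) ∧ R ≤ dBI b c ∧ G * ((k : ℝ) - (c.1.1 : ℕ) - gap) ≤ dBI b c) :
    ∀ c : BondIdx D, Real.exp (-(δ₀ / 2 * dBI b c)) * |X c| ≤
      max β₁ (Real.exp (-((δ₀ / 2 - τ) * R)) * (2 : ℝ) ^ gap * β₂ * ε k) * ((dBI b c + 1) * (P.L : ℝ) ^ (k - (c.1.1 : ℕ))) := by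
  intro c
  have hL0 : (0 : ℝ) ≤ (P.L : ℝ) ^ (k - (c.1.1 : ℕ)) := by positivity
  have hd1 : (0 : ℝ) ≤ dBI b c + 1 := by linarith [hd c]
  have hprod : 0 ≤ (dBI b c + 1) * (P.L : ℝ) ^ (k - (c.1.1 : ℕ)) := mul_nonneg hd1 hL0
  by_cases hc : near c
  · have hexp1 : Real.exp (-(δ₀ / 2 * dBI b c)) ≤ 1 := by
      rw [Real.exp_le_one_iff]; nlinarith [hd c]
    calc Real.exp (-(δ₀ / 2 * dBI b c)) * |X c| ≤ 1 * |X c| :=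
          mul_le_mul_of_nonneg_right hexp1 (abs_nonneg _)
      _ ≤ β₁ * ((dBI b c + 1) * (P.L : ℝ) ^ (k - (c.1.1 : ℕ))) := by rw [one_mul]; exact hnear c hc
      _ ≤ max β₁ (Real.exp (-((δ₀ / 2 - τ) * R)) * (2 : ℝ) ^ gap * β₂ * ε k) * ((dBI b c + 1) * (P.L : ℝ) ^ (k - (c.1.1 : ℕ))) :=
          mul_le_mul_of_nonneg_right (le_max_left _ _) hprod
  · obtain ⟨hXc, hR, h60⟩ := hfar c hc
    -- the tilt: `e^{−½δ₀d} = e^{−(½δ₀−τ)d}·e^{−τd}`, `e^{−(½δ₀−τ)d} ≤ e^{−(½δ₀−τ)R}`, `e^{−τd}·2^{k−j} ≤ 2^g`; the weight `(d + 1)` rides along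
    have hsplit : Real.exp (-(δ₀ / 2 * dBI b c)) = Real.exp (-((δ₀ / 2 - τ) * dBI b c)) * Real.exp (-(τ * dBI b c)) := by
      rw [← Real.exp_add]; congr 1; ring
    have hexpR : Real.exp (-((δ₀ / 2 - τ) * dBI b c)) ≤ Real.exp (-((δ₀ / 2 - τ) * R)) := by
      rw [Real.exp_le_exp]; nlinarith
    have htilt := tilt_far_le (k := k) (j := (c.1.1 : ℕ)) (gap := gap) hτ h2 (hd c) (hjk c) h60
    have hfarX : |X c| ≤ β₂ * ((2 : ℝ) ^ (k - (c.1.1 : ℕ)) * ε k) * (P.L : ℝ) ^ (k - (c.1.1 : ℕ)) * (dBI b c + 1) :=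
      hXc.trans (mul_le_mul_of_nonneg_right
        (mul_le_mul_of_nonneg_right (mul_le_mul_of_nonneg_left (hεcomp _ (hjk c)) hβ₂) hL0) hd1)
    have hK : 0 ≤ Real.exp (-((δ₀ / 2 - τ) * R)) * (2 : ℝ) ^ gap * β₂ * ε k := by positivity
    calc Real.exp (-(δ₀ / 2 * dBI b c)) * |X c|
        ≤ (Real.exp (-((δ₀ / 2 - τ) * R)) * Real.exp (-(τ * dBI b c))) *
            (β₂ * ((2 : ℝ) ^ (k - (c.1.1 : ℕ)) * ε k) * (P.L : ℝ) ^ (k - (c.1.1 : ℕ)) * (dBI b c + 1)) := by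
          rw [hsplit]
          exact mul_le_mul (mul_le_mul_of_nonneg_right hexpR (Real.exp_nonneg _)) hfarX (abs_nonneg _)
            (mul_nonneg (Real.exp_nonneg _) (Real.exp_nonneg _))
      _ = Real.exp (-((δ₀ / 2 - τ) * R)) * (Real.exp (-(τ * dBI b c)) * (2 : ℝ) ^ (k - (c.1.1 : ℕ))) * β₂ * ε k *
            ((dBI b c + 1) * (P.L : ℝ) ^ (k - (c.1.1 : ℕ))) := by ring
      _ ≤ Real.exp (-((δ₀ / 2 - τ) * R)) * (2 : ℝ) ^ gap * β₂ * ε k * ((dBI b c + 1) * (P.L : ℝ) ^ (k - (c.1.1 : ℕ))) := by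
          refine mul_le_mul_of_nonneg_right ?_ hprod
          exact mul_le_mul_of_nonneg_right (mul_le_mul_of_nonneg_right
            (mul_le_mul_of_nonneg_left htilt (Real.exp_nonneg _)) hβ₂) hεk
      _ ≤ max β₁ (Real.exp (-((δ₀ / 2 - τ) * R)) * (2 : ℝ) ^ gap * β₂ * ε k) * ((dBI b c + 1) * (P.L : ℝ) ^ (k - (c.1.1 : ℕ))) :=
          mul_le_mul_of_nonneg_right (le_max_right _ _) hprod

/-- ★★ **(164) WITH LEVEL-DEPENDENT FAR RADII AND THE FAR DATUM DISTANCE-WEIGHTED, IN THE P2 LETTERS**: `HDecayLetterD` ∧ `RowSum162` ∧ NEAR datum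
`|X(c)| ≤ C·M_Δ·ε₁·(d+1)L^{k−j(c)}` ((160)) ∧ FAR datum `|X(c)| ≤ C·M_Δ·ε(j(c))·L^{k−j(c)}·(d+1)` ((155) with print's weight `(d(y₁,y₂) + M_Δ) ≤ M_Δ(d+1)`) behind `R ≤ d(b,c)` ((144)) and
`G·(k − j(c) − g) ≤ d(b,c)` ((2.60)) ∧ a tilt `0 ≤ τ ≤ ½δ₀`, `2 ≤ e^{τG}` ∧ (163′) `4CB₀B₃·e^{−(½δ₀−τ)R}·2^g ≤ θ` ⇒ the four left-weighted rows at `b` are `≤ ¼M_Δ·max{B₃′ε₁, θ·ε(k)}`,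
`B₃′ = 4CB₀B₃` — (c)'s `rows164_quarter_levelRadii` with the weight restored on the far side. [cite: Balaban1985Variational, (155) p.302, (160)–(164) pp.303–304, (144) p.300; Balaban1984PropagatorsII, (2.60) p.234] -/
theorem rows164_quarter_levelRadii_farW {dBI : PBond P 0 → BondIdx D → ℝ} {w : ℕ → PBond P 0 → ℝ}
    {H : (BondIdx D → ℝ) →ₗ[ℝ] (PBond P 0 → ℝ)} {δ₀ τ B₀ B₃ C MΔ ε₁ R G θ : ℝ} {ε : ℕ → ℝ} {gap : ℕ}
    (hH : HDecayLetterD P k D dBI w H B₀ δ₀) (h162 : RowSum162 P k D dBI w δ₀ B₃) (hB₀ : 0 ≤ B₀)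
    (hC : 0 ≤ C) (hM : 0 ≤ MΔ) (hε₁ : 0 ≤ ε₁) (hεk : 0 ≤ ε k) (hεcomp : ∀ j, j ≤ k → ε j ≤ (2 : ℝ) ^ (k - j) * ε k)
    (hτ : 0 ≤ τ) (hτδ : τ ≤ δ₀ / 2) (h2 : 2 ≤ Real.exp (τ * G))
    (h163 : 4 * C * B₀ * B₃ * (Real.exp (-((δ₀ / 2 - τ) * R)) * (2 : ℝ) ^ gap) ≤ θ)
    (near : BondIdx D → Prop) {X : BondIdx D → ℝ} {b : PBond P 0} (hwb : 0 ≤ w 1 b) (hd : ∀ c, 0 ≤ dBI b c) (hjk : ∀ c : BondIdx D, (c.1.1 : ℕ) ≤ k)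
    (hnear : ∀ c, near c → |X c| ≤ C * MΔ * ε₁ * ((dBI b c + 1) * (P.L : ℝ) ^ (k - (c.1.1 : ℕ))))
    (hfar : ∀ c, ¬ near c →
      |X c| ≤ C * MΔ * ε (c.1.1 : ℕ) * (P.L : ℝ) ^ (k - (c.1.1 : ℕ)) * (dBI b c + 1) ∧ R ≤ dBI b c ∧
        G * ((k : ℝ) - (c.1.1 : ℕ) - gap) ≤ dBI b c) :
    w 1 b * (w 1 b * |H X b|) ≤ 1 / 4 * MΔ * max (4 * C * B₀ * B₃ * ε₁) (θ * ε k) ∧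
    (∀ ν : Fin P.d, w 1 b * (w 2 b * (P.L : ℝ) ^ k * |H X ⟨b.src.shift ν, b.dir⟩ - H X b|) ≤
      1 / 4 * MΔ * max (4 * C * B₀ * B₃ * ε₁) (θ * ε k)) ∧
    w 1 b * (w 3 b * |(dcsE ((P.L : ℝ) ^ k) (dcE ((P.L : ℝ) ^ k) (WithLp.toLp 2 (H X)))) b|) ≤
      1 / 4 * MΔ * max (4 * C * B₀ * B₃ * ε₁) (θ * ε k) ∧
    w 1 b * (w 3 b * ((P.L : ℝ) ^ k) ^ 2 *
        |∑ ν : Fin P.d, ((H X b - H X ⟨b.src.shift ν, b.dir⟩) + (H X b - H X ⟨b.src.unshift ν, b.dir⟩))|) ≤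
      1 / 4 * MΔ * max (4 * C * B₀ * B₃ * ε₁) (θ * ε k) := by
  -- the tilted remoteness factor `ϑ := e^{−(½δ₀−τ)R}·2^g` plays print's `e^{−½δ₀R₁M₁}`, `ε(k)` plays `ε₀`
  set ϑ : ℝ := Real.exp (-((δ₀ / 2 - τ) * R)) * (2 : ℝ) ^ gap with hϑ
  have hβ₂ : 0 ≤ C * MΔ := by positivity
  have hX := effDatum_of_near_farW_levelRadii dBI hτ hτδ h2 hβ₂ hεk hεcomp near X b hd hjk hnear hfar
  have hβeq : max (C * MΔ * ε₁) (Real.exp (-((δ₀ / 2 - τ) * R)) * (2 : ℝ) ^ gap * (C * MΔ) * ε k) = C * MΔ * max ε₁ (ϑ * ε k) := by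
    rw [show Real.exp (-((δ₀ / 2 - τ) * R)) * (2 : ℝ) ^ gap * (C * MΔ) * ε k = C * MΔ * (ϑ * ε k) by rw [hϑ]; ring,
      ← mul_max_of_nonneg _ _ hβ₂]
  rw [hβeq] at hX
  have hβ : 0 ≤ C * MΔ * max ε₁ (ϑ * ε k) := mul_nonneg hβ₂ (le_max_of_le_left hε₁)
  obtain ⟨r1, r2, r3, r4⟩ := rows164_of_hDecayLetterD hH h162 hB₀ hβ hwb hX
  -- (163′) ⇒ the quarter, with `θ·ε(k)` in place of `½ε₀`
  have hmax : 4 * C * B₀ * B₃ * max ε₁ (ϑ * ε k) ≤ max (4 * C * B₀ * B₃ * ε₁) (θ * ε k) := by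
    rcases le_total ε₁ (ϑ * ε k) with h | h
    · rw [max_eq_right h]
      calc 4 * C * B₀ * B₃ * (ϑ * ε k) = (4 * C * B₀ * B₃ * ϑ) * ε k := by ring
        _ ≤ θ * ε k := mul_le_mul_of_nonneg_right h163 hεk
        _ ≤ max (4 * C * B₀ * B₃ * ε₁) (θ * ε k) := le_max_right _ _
    · rw [max_eq_left h]
      exact le_max_left _ _
  have hq : B₀ * B₃ * (C * MΔ * max ε₁ (ϑ * ε k)) ≤ 1 / 4 * MΔ * max (4 * C * B₀ * B₃ * ε₁) (θ * ε k) :=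
    calc B₀ * B₃ * (C * MΔ * max ε₁ (ϑ * ε k)) = 1 / 4 * MΔ * (4 * C * B₀ * B₃ * max ε₁ (ϑ * ε k)) := by ring
      _ ≤ 1 / 4 * MΔ * max (4 * C * B₀ * B₃ * ε₁) (θ * ε k) := mul_le_mul_of_nonneg_left hmax (by positivity)
  exact ⟨r1.trans hq, fun ν => (r2 ν).trans hq, r3.trans hq, r4.trans hq⟩

/-- a bound `|x| ≤ a·(t + 1)` with `t ≥ 0` forces `0 ≤ a` (used to transport the weighted far hypothesis from the physical distance `distBI` to the port distance `dBI ≥ distBI`). [folklore] -/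
theorem coef_nonneg_of_abs_le_mul {a x t : ℝ} (ht : 0 ≤ t) (h : |x| ≤ a * (t + 1)) : 0 ≤ a := by
  by_contra hneg
  have : a * (t + 1) < 0 := mul_neg_of_neg_of_pos (lt_of_not_ge hneg) (by linarith)
  linarith [abs_nonneg x]

end Carrier

/-! ## §2 The S5 socket at EVERY admissible family of NODE 00's four-tori, far slot distance-weighted (P12's binder block otherwise verbatim) -/

/-- ★★★ **(164) FOR THE CANONICAL FLAT `H` OF EVERY (2.1)–(2.2)-ADMISSIBLE NESTED FAMILY ON NODE 00's FOUR-TORI, FAR DATUM DISTANCE-WEIGHTED** — P12's `hbRows164_core_of_adm22_T4` with the SAME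
constants and binder block except the far hypothesis, which now reads `∀ c, j(c) < K − n → |X c| ≤ C_d·M_Δ·ε(j(c))·L^{K−n−j(c)}·(distBI D b c + 1)` (print's (161) line 4: the far size
times `(d(y₁,y₂) + M_Δ) ≤ M_Δ·(d + 1)`): there are `M_h⁰, R₀ : ℕ` and `C ≥ 0`, `δ₀ > 0`, `δ₁ > 0`, `B₃ > 0` such that for all heights `1 ≤ K − n`, `K − n + 1 ≤ F.m + K`, big blocks
`M_h = L^{a′} ≥ M_h⁰`, `R ≥ R₀`, `a′ + 3 ≤ F.m + n`, every `D : Domains (F.P K)` with `D.k = K − n`, `Adm22 D R (L·M_h)`, every level-weight family `w`, all `C_d, M_Δ, ε₁ ≥ 0`, radii `ε`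
(`0 ≤ ε(K−n)`, `ε j ≤ 2ε(j+1)`), every core collar `R′` and far coefficient `θ` with `8C_d·C·B₃·e^{−δ₁R′} ≤ θ`, every observation bond `b` in the top domain whose lower-level index bonds
are `R′`-far in the physical distance, and every datum `X` with NEAR cells `|X c| ≤ C_d·M_Δ·ε₁·(distBI D b c + 1)` and FAR cells `|X c| ≤ C_d·M_Δ·ε(j(c))·L^{K−n−j(c)}·(distBI D b c + 1)`:
the four left-weighted rows of `H := flatH (F.P K) (K − n) D` at `b` are `≤ ¼M_Δ·max{4C_dCB₃·ε₁, θ·ε(K − n)}` ((2.60) discharged inside by P11's exported separation, tilt `τ = ¼δ₀`,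
`δ₁ = ¼δ₀`, exactly as in P12). [cite: Balaban1985Variational, (144) p.300, (155) p.302, (160)–(164) pp.303–304; Balaban1984PropagatorsII, (2.1)–(2.2) p.224, (2.46) p.231, (2.60) p.234, Cor. 2.8 (2.150)–(2.151) p.249; Balaban1987RG1, (0.1) p.251] -/
theorem hbRows164_core_of_adm22_T4_farW (F : T4Family) :
    ∃ (Mh₀ R₀ : ℕ) (C δ₀ δ₁ B₃ : ℝ), 0 ≤ C ∧ 0 < δ₀ ∧ 0 < δ₁ ∧ 0 < B₃ ∧
    ∀ (n K : ℕ) (_ : 1 ≤ K - n) (_ : K - n + 1 ≤ F.m + K) {Mh R a' : ℕ} (_ : Mh = F.L ^ a') (_ : Mh₀ ≤ Mh) (_ : R₀ ≤ R) (_ : a' + 3 ≤ F.m + n)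
      (D : Domains (F.P K)) (_ : D.k = K - n) (_ : Adm22 D R (F.L * Mh))
      (w : ℕ → PBond (F.P K) 0 → ℝ) (_ : IsLevWeight (F.P K) (K - n) D w)
      {Cd MΔ ε₁ θ R' : ℝ} {ε : ℕ → ℝ}
      (_ : 0 ≤ Cd) (_ : 0 ≤ MΔ) (_ : 0 ≤ ε₁) (_ : 0 ≤ ε (K - n)) (_ : ∀ j, j < K - n → ε j ≤ 2 * ε (j + 1))
      (_ : 8 * Cd * C * B₃ * Real.exp (-(δ₁ * R')) ≤ θ)
      {X : BondIdx D → ℝ} {b : PBond (F.P K) 0}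
      (_ : D.InOm (K - n) b.src) (_ : ∀ c : BondIdx D, (c.1.1 : ℕ) < K - n → R' ≤ distBI D b c)
      (_ : ∀ c, (c.1.1 : ℕ) = K - n → |X c| ≤ Cd * MΔ * ε₁ * (distBI D b c + 1))
      (_ : ∀ c, (c.1.1 : ℕ) < K - n →
        |X c| ≤ Cd * MΔ * ε (c.1.1 : ℕ) * ((F.P K).L : ℝ) ^ ((K - n) - (c.1.1 : ℕ)) * (distBI D b c + 1)),
      w 1 b * (w 1 b * |flatH (F.P K) (K - n) D X b|) ≤
        1 / 4 * MΔ * max (4 * Cd * C * B₃ * ε₁) (θ * ε (K - n)) ∧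
      (∀ ν : Fin (F.P K).d, w 1 b * (w 2 b * ((F.P K).L : ℝ) ^ (K - n) *
          |flatH (F.P K) (K - n) D X ⟨b.src.shift ν, b.dir⟩ -
            flatH (F.P K) (K - n) D X b|) ≤
        1 / 4 * MΔ * max (4 * Cd * C * B₃ * ε₁) (θ * ε (K - n))) ∧
      w 1 b * (w 3 b * |(dcsE (((F.P K).L : ℝ) ^ (K - n)) (dcE (((F.P K).L : ℝ) ^ (K - n))
          (WithLp.toLp 2 (flatH (F.P K) (K - n) D X)))) b|) ≤
        1 / 4 * MΔ * max (4 * Cd * C * B₃ * ε₁) (θ * ε (K - n)) ∧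
      w 1 b * (w 3 b * (((F.P K).L : ℝ) ^ (K - n)) ^ 2 *
          |∑ ν : Fin (F.P K).d, ((flatH (F.P K) (K - n) D X b -
              flatH (F.P K) (K - n) D X ⟨b.src.shift ν, b.dir⟩) +
            (flatH (F.P K) (K - n) D X b -
              flatH (F.P K) (K - n) D X ⟨b.src.unshift ν, b.dir⟩))|) ≤
        1 / 4 * MΔ * max (4 * Cd * C * B₃ * ε₁) (θ * ε (K - n)) := by
  obtain ⟨Mh₀, R₀, C, δ₀, B₃, hC, hδ₀, hB₃, hmain⟩ := hRowsSep_of_adm22_T4 F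
  refine ⟨Mh₀, max R₀ (⌈4 * Real.log 2 / δ₀⌉₊ + 2), C, δ₀, δ₀ / 4, B₃, hC, hδ₀, div_pos hδ₀ four_pos, hB₃, ?_⟩
  intro n K hk1 hk' Mh R a' hMha hMh hR hsize D hDk hAdm w hw Cd MΔ ε₁ θ R' ε hCd hMΔ hε₁ hεk hcomp h163 X b hbΩ hcollar hnear hfar
  have hR₀ : R₀ ≤ R := le_trans (le_max_left _ _) hR
  obtain ⟨-, -, dBI, hcompD, hsep, hrow, hdec⟩ := hmain n K hk1 hk' hMha hMh hR₀ hsize D hDk hAdm w hw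
  -- `1 ≤ L·M_h` (as `M_h = L^{a′}`, `L ≥ 1`)
  have hM : 1 ≤ F.L * Mh := by
    rw [hMha]
    exact Nat.one_le_iff_ne_zero.mpr (Nat.mul_ne_zero (by have := F.hL11; omega) (pow_ne_zero _ (by have := F.hL11; omega)))
  -- the per-layer gap `G₀ = R·L·M_h − 1` and the tilt `τ = ¼δ₀`
  set G₀ : ℝ := ((R * (F.L * Mh) - 1 : ℕ) : ℝ) with hG₀def
  have hRq : ⌈4 * Real.log 2 / δ₀⌉₊ + 2 ≤ R := le_trans (le_max_right _ _) hR
  have hRM : R ≤ R * (F.L * Mh) := Nat.le_mul_of_pos_right R hM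
  have hnat : ⌈4 * Real.log 2 / δ₀⌉₊ + 1 ≤ R * (F.L * Mh) - 1 := by omega
  have hG₀ : 4 * Real.log 2 / δ₀ ≤ G₀ := by
    have h1 : (4 * Real.log 2 / δ₀ : ℝ) ≤ ⌈4 * Real.log 2 / δ₀⌉₊ := Nat.le_ceil _
    have h2 : ((⌈4 * Real.log 2 / δ₀⌉₊ + 1 : ℕ) : ℝ) ≤ G₀ := by rw [hG₀def]; exact_mod_cast hnat
    push_cast at h2
    linarith
  have h2 : 2 ≤ Real.exp (δ₀ / 4 * G₀) := two_le_exp_quarter hδ₀ hG₀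
  have hτ : (0 : ℝ) ≤ δ₀ / 4 := by positivity
  have hτδ : δ₀ / 4 ≤ δ₀ / 2 := by linarith
  have h163' := h163_of_core h163
  have hd0 : ∀ c, 0 ≤ dBI b c := fun c => (distBI_nonneg _ b c).trans (hcompD b c)
  refine rows164_quarter_levelRadii_farW hdec hrow hC hCd hMΔ hε₁ hεk (fun _ hj => le_two_pow_mul_of_comparable hcomp hj) hτ hτδ h2 h163'
    (fun c => (c.1.1 : ℕ) = K - n) (levWeight_nonneg hw 1 b) hd0 (bondIdx_level_le hDk) ?_ ?_
  · -- NEAR (top-level) cells: (160) in the physical distance `distBI ≤ dBI`, `L⁰ = 1`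
    intro c hc
    have h := hnear c hc
    rw [hc, Nat.sub_self, pow_zero, mul_one]
    have hmono : Cd * MΔ * ε₁ * (distBI D b c + 1) ≤ Cd * MΔ * ε₁ * (dBI b c + 1) :=
      mul_le_mul_of_nonneg_left (by linarith [hcompD b c]) (by positivity)
    exact h.trans hmono
  · -- FAR cells: the weighted (155) at the cell's own level, transported along `distBI ≤ dBI` (its coefficient is `≥ 0` as soon as the hypothesis holds); (144) from the core collar;
    -- (2.60) from the exported level separation
    intro c hc
    have hlt : (c.1.1 : ℕ) < K - n := lt_of_le_of_ne (bondIdx_level_le hDk c) hc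
    have h := hfar c hlt
    have hcoef : 0 ≤ Cd * MΔ * ε (c.1.1 : ℕ) * ((F.P K).L : ℝ) ^ ((K - n) - (c.1.1 : ℕ)) :=
      coef_nonneg_of_abs_le_mul (distBI_nonneg D b c) h
    refine ⟨h.trans (mul_le_mul_of_nonneg_left (by linarith [hcompD b c]) hcoef), (hcollar c hlt).trans (hcompD b c), ?_⟩
    have hs := hsep (K - n) b c le_rfl hbΩ hlt
    simpa [hG₀def] using hs

/-! ## §3 Print's letters: a UNIFORM far datum proportional to the cube size, the collar absorbing it ((161) line 3 → 4: `M = M_ΔR₁M₁ ≤ d(y₁,y₂) + M_Δ`) -/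

/-- `0 ≤ R′ ≤ t` and `1 ≤ M_Δ` ⇒ `R′ + M_Δ ≤ M_Δ·(t + 1)` — print's «M ≤ d(y₁,y₂) + M_Δ» followed by «d + M_Δ ≤ M_Δ(d + 1)». [cite: Balaban1985Variational, (161) p.303, bookkeeping] -/
theorem collar_add_le_mul {R' MΔ t : ℝ} (hR' : R' ≤ t) (ht : 0 ≤ t) (hM : 1 ≤ MΔ) : R' + MΔ ≤ MΔ * (t + 1) := by
  nlinarith

/-- ★★ **(164) WITH PRINT'S FAR LETTERS — THE COLLAR ABSORBS THE CUBE SIZE**: P12's binder block with `1 ≤ M_Δ`, `0 ≤ R′`, the lower radii `0 ≤ ε(j)` (`j < K − n`), and the FAR datum in the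
UNIFORM-times-size shape `∀ c, j(c) < K − n → |X c| ≤ C_d·ε(j(c))·L^{K−n−j(c)}·(R′ + M_Δ)` (print's `18d²L³Mε₀` with `M = M′R₁M₁`, at the record `∝ (ρ + M)·ε₀` by (145)–(146)): since the far
cells are `R′`-far (`R′ ≤ distBI D b c`, the SAME collar hypothesis), `C_d·ε·L^{k−j}·(R′ + M_Δ) ≤ C_d·M_Δ·ε·L^{k−j}·(distBI + 1)` and §2 applies — the rows are
`≤ ¼M_Δ·max{4C_dCB₃·ε₁, θ·ε(K − n)}` with `C_d`, `θ` FREE OF THE COLLAR (the (163)-row `8C_dCB₃e^{−δ₁R′} ≤ θ` is then N1's `exists_rho_h163` verbatim).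
[cite: Balaban1985Variational, (144) p.300, (145)–(146) p.301, (155) p.302, (160)–(164) pp.303–304; Balaban1984PropagatorsII, (2.60) p.234] -/
theorem hbRows164_core_of_adm22_T4_farCollar (F : T4Family) :
    ∃ (Mh₀ R₀ : ℕ) (C δ₀ δ₁ B₃ : ℝ), 0 ≤ C ∧ 0 < δ₀ ∧ 0 < δ₁ ∧ 0 < B₃ ∧
    ∀ (n K : ℕ) (_ : 1 ≤ K - n) (_ : K - n + 1 ≤ F.m + K) {Mh R a' : ℕ} (_ : Mh = F.L ^ a') (_ : Mh₀ ≤ Mh) (_ : R₀ ≤ R) (_ : a' + 3 ≤ F.m + n)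
      (D : Domains (F.P K)) (_ : D.k = K - n) (_ : Adm22 D R (F.L * Mh))
      (w : ℕ → PBond (F.P K) 0 → ℝ) (_ : IsLevWeight (F.P K) (K - n) D w)
      {Cd MΔ ε₁ θ R' : ℝ} {ε : ℕ → ℝ}
      (_ : 0 ≤ Cd) (_ : 1 ≤ MΔ) (_ : 0 ≤ ε₁) (_ : 0 ≤ ε (K - n)) (_ : ∀ j, j < K - n → 0 ≤ ε j) (_ : ∀ j, j < K - n → ε j ≤ 2 * ε (j + 1))
      (_ : 0 ≤ R') (_ : 8 * Cd * C * B₃ * Real.exp (-(δ₁ * R')) ≤ θ)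
      {X : BondIdx D → ℝ} {b : PBond (F.P K) 0}
      (_ : D.InOm (K - n) b.src) (_ : ∀ c : BondIdx D, (c.1.1 : ℕ) < K - n → R' ≤ distBI D b c)
      (_ : ∀ c, (c.1.1 : ℕ) = K - n → |X c| ≤ Cd * MΔ * ε₁ * (distBI D b c + 1))
      (_ : ∀ c, (c.1.1 : ℕ) < K - n → |X c| ≤ Cd * ε (c.1.1 : ℕ) * ((F.P K).L : ℝ) ^ ((K - n) - (c.1.1 : ℕ)) * (R' + MΔ)),
      w 1 b * (w 1 b * |flatH (F.P K) (K - n) D X b|) ≤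
        1 / 4 * MΔ * max (4 * Cd * C * B₃ * ε₁) (θ * ε (K - n)) ∧
      (∀ ν : Fin (F.P K).d, w 1 b * (w 2 b * ((F.P K).L : ℝ) ^ (K - n) *
          |flatH (F.P K) (K - n) D X ⟨b.src.shift ν, b.dir⟩ -
            flatH (F.P K) (K - n) D X b|) ≤
        1 / 4 * MΔ * max (4 * Cd * C * B₃ * ε₁) (θ * ε (K - n))) ∧
      w 1 b * (w 3 b * |(dcsE (((F.P K).L : ℝ) ^ (K - n)) (dcE (((F.P K).L : ℝ) ^ (K - n))
          (WithLp.toLp 2 (flatH (F.P K) (K - n) D X)))) b|) ≤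
        1 / 4 * MΔ * max (4 * Cd * C * B₃ * ε₁) (θ * ε (K - n)) ∧
      w 1 b * (w 3 b * (((F.P K).L : ℝ) ^ (K - n)) ^ 2 *
          |∑ ν : Fin (F.P K).d, ((flatH (F.P K) (K - n) D X b -
              flatH (F.P K) (K - n) D X ⟨b.src.shift ν, b.dir⟩) +
            (flatH (F.P K) (K - n) D X b -
              flatH (F.P K) (K - n) D X ⟨b.src.unshift ν, b.dir⟩))|) ≤
        1 / 4 * MΔ * max (4 * Cd * C * B₃ * ε₁) (θ * ε (K - n)) := by
  obtain ⟨Mh₀, R₀, C, δ₀, δ₁, B₃, hC, hδ₀, hδ₁, hB₃, hmain⟩ := hbRows164_core_of_adm22_T4_farW F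
  refine ⟨Mh₀, R₀, C, δ₀, δ₁, B₃, hC, hδ₀, hδ₁, hB₃, ?_⟩
  intro n K hk1 hk' Mh R a' hMha hMh hR hsize D hDk hAdm w hw Cd MΔ ε₁ θ R' ε hCd hMΔ hε₁ hεk hεpos hcomp hR' h163 X b hbΩ hcollar hnear hfar
  refine hmain n K hk1 hk' hMha hMh hR hsize D hDk hAdm w hw hCd (zero_le_one.trans hMΔ) hε₁ hεk hcomp h163 hbΩ hcollar hnear fun c hc => ?_
  -- `C_d·ε·L^{k−j}·(R′ + M_Δ) ≤ C_d·M_Δ·ε·L^{k−j}·(distBI + 1)`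
  have hcoef : 0 ≤ Cd * ε (c.1.1 : ℕ) * ((F.P K).L : ℝ) ^ ((K - n) - (c.1.1 : ℕ)) :=
    mul_nonneg (mul_nonneg hCd (hεpos _ hc)) (by positivity)
  have hw' := collar_add_le_mul (hcollar c hc) (distBI_nonneg D b c) hMΔ
  calc |X c| ≤ Cd * ε (c.1.1 : ℕ) * ((F.P K).L : ℝ) ^ ((K - n) - (c.1.1 : ℕ)) * (R' + MΔ) := hfar c hc
    _ ≤ Cd * ε (c.1.1 : ℕ) * ((F.P K).L : ℝ) ^ ((K - n) - (c.1.1 : ℕ)) * (MΔ * (distBI D b c + 1)) :=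
        mul_le_mul_of_nonneg_left hw' hcoef
    _ = Cd * MΔ * ε (c.1.1 : ℕ) * ((F.P K).L : ℝ) ^ ((K - n) - (c.1.1 : ℕ)) * (distBI D b c + 1) := by ring

/-- ★ **PRINT'S CASE**: uniform far radius `ε ≡ ε₀ ≥ 0` and the far datum `|X c| ≤ C_d·ε₀·L^{K−n−j(c)}·(R′ + M_Δ)` ((151)∕(155): `|B| < 18d²L³Mε₀`, `M = M′R₁M₁`; p. 303: `M_Δ = 1` for `Δ = Δ₀`,
`M_Δ = M` for `Δ = □`), `1 ≤ M_Δ`, `0 ≤ R′ ≤ distBI` on the far cells ⇒ the rows `≤ ¼M_Δ·max{4C_dCB₃·ε₁, θ·ε₀}` with `C_d`, `θ` free of the collar — print's (164) at `θ = ½`.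
[cite: Balaban1985Variational, (144) p.300, (145)–(151) p.301, (155) p.302, (160)–(164) pp.303–304] -/
theorem hbRows164_uniform_core_of_adm22_T4_farCollar (F : T4Family) :
    ∃ (Mh₀ R₀ : ℕ) (C δ₀ δ₁ B₃ : ℝ), 0 ≤ C ∧ 0 < δ₀ ∧ 0 < δ₁ ∧ 0 < B₃ ∧
    ∀ (n K : ℕ) (_ : 1 ≤ K - n) (_ : K - n + 1 ≤ F.m + K) {Mh R a' : ℕ} (_ : Mh = F.L ^ a') (_ : Mh₀ ≤ Mh) (_ : R₀ ≤ R) (_ : a' + 3 ≤ F.m + n)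
      (D : Domains (F.P K)) (_ : D.k = K - n) (_ : Adm22 D R (F.L * Mh))
      (w : ℕ → PBond (F.P K) 0 → ℝ) (_ : IsLevWeight (F.P K) (K - n) D w)
      {Cd MΔ ε₁ θ R' ε₀ : ℝ}
      (_ : 0 ≤ Cd) (_ : 1 ≤ MΔ) (_ : 0 ≤ ε₁) (_ : 0 ≤ ε₀) (_ : 0 ≤ R')
      (_ : 8 * Cd * C * B₃ * Real.exp (-(δ₁ * R')) ≤ θ)
      {X : BondIdx D → ℝ} {b : PBond (F.P K) 0}
      (_ : D.InOm (K - n) b.src) (_ : ∀ c : BondIdx D, (c.1.1 : ℕ) < K - n → R' ≤ distBI D b c)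
      (_ : ∀ c, (c.1.1 : ℕ) = K - n → |X c| ≤ Cd * MΔ * ε₁ * (distBI D b c + 1))
      (_ : ∀ c, (c.1.1 : ℕ) < K - n → |X c| ≤ Cd * ε₀ * ((F.P K).L : ℝ) ^ ((K - n) - (c.1.1 : ℕ)) * (R' + MΔ)),
      w 1 b * (w 1 b * |flatH (F.P K) (K - n) D X b|) ≤
        1 / 4 * MΔ * max (4 * Cd * C * B₃ * ε₁) (θ * ε₀) ∧
      (∀ ν : Fin (F.P K).d, w 1 b * (w 2 b * ((F.P K).L : ℝ) ^ (K - n) *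
          |flatH (F.P K) (K - n) D X ⟨b.src.shift ν, b.dir⟩ -
            flatH (F.P K) (K - n) D X b|) ≤
        1 / 4 * MΔ * max (4 * Cd * C * B₃ * ε₁) (θ * ε₀)) ∧
      w 1 b * (w 3 b * |(dcsE (((F.P K).L : ℝ) ^ (K - n)) (dcE (((F.P K).L : ℝ) ^ (K - n))
          (WithLp.toLp 2 (flatH (F.P K) (K - n) D X)))) b|) ≤
        1 / 4 * MΔ * max (4 * Cd * C * B₃ * ε₁) (θ * ε₀) ∧
      w 1 b * (w 3 b * (((F.P K).L : ℝ) ^ (K - n)) ^ 2 *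
          |∑ ν : Fin (F.P K).d, ((flatH (F.P K) (K - n) D X b -
              flatH (F.P K) (K - n) D X ⟨b.src.shift ν, b.dir⟩) +
            (flatH (F.P K) (K - n) D X b -
              flatH (F.P K) (K - n) D X ⟨b.src.unshift ν, b.dir⟩))|) ≤
        1 / 4 * MΔ * max (4 * Cd * C * B₃ * ε₁) (θ * ε₀) := by
  obtain ⟨Mh₀, R₀, C, δ₀, δ₁, B₃, hC, hδ₀, hδ₁, hB₃, hmain⟩ := hbRows164_core_of_adm22_T4_farCollar F
  refine ⟨Mh₀, R₀, C, δ₀, δ₁, B₃, hC, hδ₀, hδ₁, hB₃, ?_⟩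
  intro n K hk1 hk' Mh R a' hMha hMh hR hsize D hDk hAdm w hw Cd MΔ ε₁ θ R' ε₀ hCd hMΔ hε₁ hε₀ hR' h163 X b hbΩ hcollar hnear hfar
  exact hmain n K hk1 hk' hMha hMh hR hsize D hDk hAdm w hw (ε := fun _ => ε₀) hCd hMΔ hε₁ hε₀ (fun _ _ => hε₀) (fun j _ => by linarith)
    hR' h163 hbΩ hcollar hnear hfar

/-! ## §4 The alternative road's numerics: «R₁M₁ sufficiently big» with an AFFINE prefactor (for consumers keeping the unweighted far slot with `C_d = c₀ρ + c₁`) -/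

/-- `(c₀t + c₁)·e^{−δt} ≤ (2c₀∕δ + c₁)·e^{−½δt}` for `t ≥ 0`, `δ > 0`, `c₀, c₁ ≥ 0` (`½δt ≤ e^{½δt}`, so `t·e^{−δt} ≤ (2∕δ)e^{−½δt}`). [folklore] -/
theorem affine_mul_exp_neg_le {δ c₀ c₁ : ℝ} (hδ : 0 < δ) (hc₀ : 0 ≤ c₀) (hc₁ : 0 ≤ c₁) {t : ℝ} (ht : 0 ≤ t) :
    (c₀ * t + c₁) * Real.exp (-(δ * t)) ≤ (c₀ * (2 / δ) + c₁) * Real.exp (-(δ / 2 * t)) := by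
  have h1 : δ / 2 * t ≤ Real.exp (δ / 2 * t) := by
    have := Real.add_one_le_exp (δ / 2 * t)
    linarith
  have ht' : t ≤ 2 / δ * Real.exp (δ / 2 * t) := by
    have h2 := mul_le_mul_of_nonneg_left h1 (show (0 : ℝ) ≤ 2 / δ by positivity)
    have e : 2 / δ * (δ / 2 * t) = t := by field_simp
    linarith
  have hsplit : Real.exp (-(δ * t)) = Real.exp (-(δ / 2 * t)) * Real.exp (-(δ / 2 * t)) := by
    rw [← Real.exp_add]; congr 1; ring
  have hcancel : Real.exp (δ / 2 * t) * Real.exp (-(δ / 2 * t)) = 1 := by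
    rw [← Real.exp_add]; simp
  have hmul : t * Real.exp (-(δ * t)) ≤ 2 / δ * Real.exp (-(δ / 2 * t)) :=
    calc t * Real.exp (-(δ * t)) ≤ (2 / δ * Real.exp (δ / 2 * t)) * Real.exp (-(δ * t)) :=
          mul_le_mul_of_nonneg_right ht' (Real.exp_nonneg _)
      _ = 2 / δ * (Real.exp (δ / 2 * t) * Real.exp (-(δ / 2 * t))) * Real.exp (-(δ / 2 * t)) := by rw [hsplit]; ring
      _ = 2 / δ * Real.exp (-(δ / 2 * t)) := by rw [hcancel, mul_one]
  have hexp : Real.exp (-(δ * t)) ≤ Real.exp (-(δ / 2 * t)) := by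
    rw [Real.exp_le_exp]; nlinarith
  calc (c₀ * t + c₁) * Real.exp (-(δ * t)) = c₀ * (t * Real.exp (-(δ * t))) + c₁ * Real.exp (-(δ * t)) := by ring
    _ ≤ c₀ * (2 / δ * Real.exp (-(δ / 2 * t))) + c₁ * Real.exp (-(δ / 2 * t)) :=
        add_le_add (mul_le_mul_of_nonneg_left hmul hc₀) (mul_le_mul_of_nonneg_left hexp hc₁)
    _ = (c₀ * (2 / δ) + c₁) * Real.exp (-(δ / 2 * t)) := by ring

/-- ★ **«R₁M₁ SUFFICIENTLY BIG» WITH AN AFFINE PREFACTOR, ON THE BIG-BLOCK GRID**: for `c₀, c₁ ≥ 0`, `θ > 0`, `δ₁ > 0`, `M₁ ≥ 1` and any `R`, `L₀` there is a collar `ρ`, a MULTIPLE of `M₁` with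
`R·M₁ ≤ ρ`, `L₀ ≤ ρ`, such that `(c₀ρ + c₁)·e^{−δ₁ρ} ≤ θ` (N1's `exists_collar_multiple` at rate `½δ₁` and `A := 2c₀∕δ₁ + c₁`, then `affine_mul_exp_neg_le`). [cite: Balaban1985Variational, (163) p.303 («We may assume that R₁M₁ is sufficiently big»)] -/
theorem exists_collar_multiple_affine {c₀ c₁ θ δ₁ : ℝ} (hc₀ : 0 ≤ c₀) (hc₁ : 0 ≤ c₁) (hθ : 0 < θ) (hδ₁ : 0 < δ₁) {M₁ : ℕ} (hM₁ : 1 ≤ M₁) (R L₀ : ℕ) :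
    ∃ ρ : ℕ, M₁ ∣ ρ ∧ R * M₁ ≤ ρ ∧ L₀ ≤ ρ ∧ (c₀ * ρ + c₁) * Real.exp (-(δ₁ * (ρ : ℝ))) ≤ θ := by
  have hA : 0 ≤ c₀ * (2 / δ₁) + c₁ := by positivity
  obtain ⟨ρ, hdvd, hR, hL, hρ⟩ := exists_collar_multiple hA hθ (half_pos hδ₁) hM₁ R L₀
  exact ⟨ρ, hdvd, hR, hL, (affine_mul_exp_neg_le hδ₁ hc₀ hc₁ (Nat.cast_nonneg ρ)).trans hρ⟩

/-- **THE (163)-ROW WITH AN AFFINE DATA COEFFICIENT `C_d := c₀ρ + c₁`**: `∃ ρ, M₁ ∣ ρ ∧ R·M₁ ≤ ρ ∧ L₀ ≤ ρ ∧ 8·(c₀ρ + c₁)·C·B₃·e^{−δ₁ρ} ≤ θ` — the unweighted socket's displayed smallness when the far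
datum carries the collar linearly. [cite: Balaban1985Variational, (163) p.303] -/
theorem exists_rho_h163_affine {c₀ c₁ C B₃ θ δ₁ : ℝ} (hc₀ : 0 ≤ c₀) (hc₁ : 0 ≤ c₁) (hC : 0 ≤ C) (hB₃ : 0 ≤ B₃) (hθ : 0 < θ) (hδ₁ : 0 < δ₁)
    {M₁ : ℕ} (hM₁ : 1 ≤ M₁) (R L₀ : ℕ) :
    ∃ ρ : ℕ, M₁ ∣ ρ ∧ R * M₁ ≤ ρ ∧ L₀ ≤ ρ ∧ 8 * (c₀ * ρ + c₁) * C * B₃ * Real.exp (-(δ₁ * (ρ : ℝ))) ≤ θ := by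
  obtain ⟨ρ, hdvd, hR, hL, hρ⟩ :=
    exists_collar_multiple_affine (c₀ := 8 * C * B₃ * c₀) (c₁ := 8 * C * B₃ * c₁) (by positivity) (by positivity) hθ hδ₁ hM₁ R L₀
  refine ⟨ρ, hdvd, hR, hL, ?_⟩
  calc 8 * (c₀ * ρ + c₁) * C * B₃ * Real.exp (-(δ₁ * (ρ : ℝ)))
      = (8 * C * B₃ * c₀ * ρ + 8 * C * B₃ * c₁) * Real.exp (-(δ₁ * (ρ : ℝ))) := by ring
    _ ≤ θ := hρ

end Summit.QuantumFields.YangMills.Theorems.K0S5FarSlotWeighted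

end
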